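/-
Copyright (c) 2026 the pub-hodgecm-mathlib formalisation cell (harness21).  Prover seat hodgecm-mathlib-A-p19 (g28): «S3-ram» seeding wave (LEAD F0P3a-plan (g12)
T11-88∕T11-89; owner F0P3a-p06 (g15)), socket (Lit2) of the fold v7.6 — the ANISOTROPIC (opposite-sign) v-deep literal at a tamely ramified CM place; 2026-09-02.
-/
import Literature.NumberTheory.Rogawski1990.TypeTwoAnisotropicTwistAlgebra                          -- (this seat) the signed generator algebra, `G₁`, `Ψ_{x,y}`, the valued kit
import Literature.NumberTheory.Rogawski1990.StableClassesTypeTwoQuadraticBlock                        -- ★ (F0P3-p04): `exists_nonscalar_hermStar_eq_sq_eq_smul`, `not_isSquare_of_kappa`, …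
import Literature.NumberTheory.LocalFields.RamifiedPlaceNormDictionary                                -- ★ p847338 (A-p19 (g27)): `exists_valued_eq_zpow_two_mul_of_galAdicCompletionMap_eq_of_ramified`
import Literature.NumberTheory.Automorphic.UnitaryDiagonalUnitFormsIntegralFramesRamified            -- ★ p846940 (F0P3a-p08): `exists_glInt_formCongr_antidiagonal_eq_of_map_mul_self_eq_neg_det_adicCompletion`; brings `ramifiedBlock_adicCompletion`
import HarnessLib

/-!
# The opposite-sign 2-deep literal of a type-(2) element at a TAMELY RAMIFIED CM place, I: the `⋆`-eigen generator with UNIT square and the anisotropic twist data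
# (Rogawski 1990 §3.5 Prop. 3.5.2, §3.6; Labesse–Langlands 1979 §2; Serre, Local Fields V §3, XIV §4)

Topic `NumberTheory/Rogawski1990`; namespace `Literature.NumberTheory.Rogawski1990`.  THEOREMS ONLY (no definition, no instance, no notation, no named fact, no `sorry`); kernel lane
`--supports stmt-HodgeConjecture-24833`.  Cell `pub/hodgecm-mathlib` (D-0151), crux H413; road «S3-ram», fold `LocalTransferAtOneTameRamified` v7.6, socket **(Lit2)**
`stub_typeTwo_literals_{even,odd}_ram`.  The frame literal `t₀` (sign `(y_λ,θ)_v`) is ★ F0P3a-p03 (g17) `TypeTwoRamifiedFrameLiteral`; this file constructs, at the level of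
`U(σ_w, J₀)(L_w)`, the element `Y` whose pull-back along the wave's one-place frame is the literal of the OPPOSITE sign, with its 2-depth, its matching and its κ-datum.
HONEST LABEL: HC_CM is proved only modulo the cell's 2 remaining named inputs (hLiu418 24832, h413 24833) until rung 0 closes; unconditional local algebra, count-neutral.

THE MATHEMATICS.  `w ∣ v` non-split, TAMELY RAMIFIED (`e ≠ 1`, `|2|_w = 1`), `σ = σ_w`, `ϖ` an anti-fixed uniformiser.  For `g ∈ U(Φ₂)(L_w)` of type (2) (`χ_g` rootless):
(§1 `exists_signedGenerator_coords_ramified`) ★ `exists_nonscalar_hermStar_eq_sq_eq_smul` (skew element `ϖ`) gives `κ = α₀ + β₀g`, `κ⋆ = κ`, `κ² = k₀`, `k₀` σ-fixed NON-square; σ-fixed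
elements have EVEN order (★ `exists_valued_eq_zpow_two_mul_of_galAdicCompletionMap_eq_of_ramified`), `|k₀| = |ϖ|^{2k}`, and `Π := ϖ^{−k}•κ = (p q; r −p)` has `Π² = D•1` with **`D` a
σ-fixed NON-square UNIT**, `Π⋆ = s₀Π`, `s₀ = σ(ϖ^{−k})∕ϖ^{−k} ∈ {±1}`; coordinates `g = φ₀ + φ₁Π` with (R1ₛ), (R2ₛ) (★ `typeTwo_relations_of_unitary_signed`).
(§2 `exists_twistData_ramified`) σ-fixed-up-to-sign integral `x, y` with `x² − Dy² ≡ −s₀ (mod 𝔪_w)`: `(1, 0)` if `s₀ = −1`; if `s₀ = 1`, a solution of `a² + 1 − D̄b² = 0` in the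
(finite, odd) residue field (Mathlib `FiniteField.exists_root_sum_quadratic`), lifted and σ-symmetrised.  Then `Ψ := (x, yD; s₀Dy, s₀Dx)` is a UNIMODULAR σ-hermitian plane
preserved by `G₁ = (φ₀ φ₁D; φ₁ φ₀)` (★ `regRep_unitary`) with `−det Ψ = −s₀D(x² − Dy²) ≡ D`: NOT a norm (a σ-fixed unit norm has square residue, ★ (U1), and Hensel ★
`isSquare_coe_of_isUnit_of_isSquare_residue` would make `D` a square).
The sequel `TypeTwoAnisotropicLiteralRamified` (§3) builds from these the unimodular plane `Ψ`, the `3 × 3` dress, the integral isometry ★ p846940 and the literal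
`Y = P·endoGL(G₁, u)·P⁻¹ ∈ U(σ_w, J₀)` with its 2-depth, its conjugacy to the pattern and its `u`-eigenvector of NON-NORM length.

## References
* [Rogawski1990] J. D. Rogawski, *Automorphic Representations of Unitary Groups in Three Variables*, Ann. of Math. Stud. 123 (1990), §3.5 Prop. 3.5.2 (a)(c) p. 29, §3.6 p. 31,
  §4.3 (4.3.2) p. 43, §4.9 Prop. 4.9.1 p. 55, §14.2 p. 233.
* [LabesseLanglands1979] J.-P. Labesse, R. P. Langlands, *L-indistinguishability for SL(2)*, Canad. J. Math. 31 (1979), §2 pp. 8–10.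
* [Jacobowitz1962] R. Jacobowitz, *Hermitian forms over local fields*, Amer. J. Math. 84 (1962), §7 Thm. 7.1, §8.
* [Serre1979] J.-P. Serre, *Local Fields*, GTM 67 (1979), Ch. V §3 Prop. 5, Cor. 2; Ch. XIV §4; Ch. II §3 (Hensel).
-/

set_option autoImplicit false

noncomputable section

open NumberField IsDedekindDomain Matrix Polynomial
open Literature.NumberTheory.Automorphic Literature.NumberTheory.Automorphic.UnitaryGroup Literature.NumberTheory.Automorphic.UnitaryLatticeTree
open Literature.NumberTheory.GaloisRepresentations
open Literature.NumberTheory.LocalFields.UnramifiedQuadraticNorm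
open Literature.NumberTheory.LocalFields.RamifiedPlaceNormDictionary Literature.NumberTheory.LocalFields.RamifiedPlaceUnitNorms
open scoped MatrixGroups ValuativeRel

namespace Literature.NumberTheory.Rogawski1990

section CM

variable (L : Type) [Field L] [NumberField L] [IsCMField L] {v : HeightOneSpectrum (𝓞 ↥(maximalRealSubfield L))}
  (w : PlacesOver L v) (hw : IsCMField.complexConj L • w.1 = w.1)

/-! ## §1 The `⋆`-eigen square-root generator with UNIT square at a tamely ramified place, and the coordinates of `g` -/

/-- `σ(ϖ^{−k}) = s₀·ϖ^{−k}` with `s₀ = (−1)^{−k} ∈ {1, −1}` for an anti-fixed `ϖ`. [cite: Serre1979, Ch. XIV §4] -/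
theorem exists_sign_galAdicCompletionMap_zpow_of_eq_neg {ϖ : w.1.adicCompletion L}
    (hσϖ : galAdicCompletionMap (L := L) (IsCMField.complexConj L) hw ϖ = -ϖ) (k : ℤ) :
    ∃ s₀ : w.1.adicCompletion L, (s₀ = 1 ∨ s₀ = -1) ∧ galAdicCompletionMap (L := L) (IsCMField.complexConj L) hw (ϖ ^ k) = s₀ * ϖ ^ k := by
  refine ⟨(-1) ^ k, ?_, ?_⟩
  · rcases Int.even_or_odd k with hk | hk
    · exact Or.inl hk.neg_one_zpow
    · exact Or.inr hk.neg_one_zpow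
  · rw [map_zpow₀, hσϖ, neg_eq_neg_one_mul, mul_zpow]

include hw in
/-- **THE SIGNED GENERATOR AND THE COORDINATES OF `g` AT A TAMELY RAMIFIED PLACE.**  For `g ∈ U(Φ₂)(L⁺_v) ≤ GL₂(L_w)` with rootless `χ_g`, `|2|_w = 1`, `e(w|v) ≠ 1` and an
anti-fixed uniformiser `ϖ`: there are `p q r D φ₀ φ₁ s₀ ∈ L_w` with `s₀ ∈ {1, −1}`, `σs₀ = s₀`, `σp = −s₀p`, `σq = s₀q`, `σr = s₀r`, `σD = D`, `p² + qr = D`, `r ≠ 0`, **`|D|_w = 1`**,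
**`D` NOT a square in `L_w`**, `g = (φ₀+φ₁p, φ₁q; φ₁r, φ₀−φ₁p)` and (R1ₛ) `σφ₀φ₁ + s₀σφ₁φ₀ = 0`, (R2ₛ) `σφ₀φ₀ + s₀D·σφ₁φ₁ = 1`.  (`Π = ϖ^{−k}•κ` for the `⋆`-fixed
`κ = α₀ + β₀g`, `κ² = k₀`, `|k₀| = |ϖ|^{2k}` — the EVEN order of σ-fixed elements at a ramified place.) [cite: Rogawski1990, §3.6 p. 31; §3.5 Prop. 3.5.2 (a) p. 29] [cite: Serre1979, Ch. XIV §4] -/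
theorem exists_signedGenerator_coords_ramified (he : v.asIdeal.ramificationIdx' w.1.asIdeal ≠ 1) (h2 : Valued.v (2 : w.1.adicCompletion L) = 1)
    {ϖ : w.1.adicCompletion L} (hϖ : Valued.v ϖ = WithZero.exp (-1 : ℤ)) (hσϖ : galAdicCompletionMap (L := L) (IsCMField.complexConj L) hw ϖ = -ϖ)
    (g : Matrix (Fin 2) (Fin 2) (w.1.adicCompletion L))
    (hgu : (g.map (galAdicCompletionMap (L := L) (IsCMField.complexConj L) hw))ᵀ * !![(0 : w.1.adicCompletion L), 1; 1, 0] * g =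
      !![(0 : w.1.adicCompletion L), 1; 1, 0])
    (hA : ∀ x : w.1.adicCompletion L, g.charpoly.eval x ≠ 0) :
    ∃ p q r D φ₀ φ₁ s₀ : w.1.adicCompletion L,
      (s₀ = 1 ∨ s₀ = -1) ∧ galAdicCompletionMap (L := L) (IsCMField.complexConj L) hw s₀ = s₀ ∧
      galAdicCompletionMap (L := L) (IsCMField.complexConj L) hw p = -(s₀ * p) ∧ galAdicCompletionMap (L := L) (IsCMField.complexConj L) hw q = s₀ * q ∧
      galAdicCompletionMap (L := L) (IsCMField.complexConj L) hw r = s₀ * r ∧ galAdicCompletionMap (L := L) (IsCMField.complexConj L) hw D = D ∧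
      p * p + q * r = D ∧ r ≠ 0 ∧ Valued.v D = 1 ∧ ¬ IsSquare D ∧
      g = !![φ₀ + φ₁ * p, φ₁ * q; φ₁ * r, φ₀ - φ₁ * p] ∧
      galAdicCompletionMap (L := L) (IsCMField.complexConj L) hw φ₀ * φ₁ + s₀ * (galAdicCompletionMap (L := L) (IsCMField.complexConj L) hw φ₁ * φ₀) = 0 ∧
      galAdicCompletionMap (L := L) (IsCMField.complexConj L) hw φ₀ * φ₀ + s₀ * D * (galAdicCompletionMap (L := L) (IsCMField.complexConj L) hw φ₁ * φ₁) = 1 := by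
  set σ := galAdicCompletionMap (L := L) (IsCMField.complexConj L) hw with hσdef
  have hc1 : IsCMField.complexConj L ≠ 1 := IsCMField.complexConj_ne_one L
  have hσσ : ∀ x, σ (σ x) = x := fun x => galAdicCompletionMap_galAdicCompletionMap_of_smul_eq (IsCMField.complexConj L) w hc1 hw x
  have hϖ0 : ϖ ≠ 0 := fun h0 => by rw [h0, map_zero] at hϖ; exact WithZero.coe_ne_zero hϖ.symm
  have h20 : (2 : w.1.adicCompletion L) ≠ 0 := fun h0 => by rw [h0, map_zero] at h2; exact zero_ne_one h2
  -- the `⋆`-fixed square-root generator `κ` of `L_w[g]` (skew element: the anti-fixed uniformiser)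
  have hGh : ((!![(0 : w.1.adicCompletion L), 1; 1, 0] : Matrix (Fin 2) (Fin 2) (w.1.adicCompletion L)).map σ)ᵀ = !![(0 : w.1.adicCompletion L), 1; 1, 0] := by
    ext i j; fin_cases i <;> fin_cases j <;> simp
  have hGd : ((!![(0 : w.1.adicCompletion L), 1; 1, 0] : Matrix (Fin 2) (Fin 2) (w.1.adicCompletion L))).det = -1 := by
    simp [Matrix.det_fin_two]
  have hG : IsUnit ((!![(0 : w.1.adicCompletion L), 1; 1, 0] : Matrix (Fin 2) (Fin 2) (w.1.adicCompletion L))).det := by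
    rw [hGd]; exact isUnit_one.neg
  obtain ⟨α₀, β₀, k₀, hβ₀, hκs, hsq, hk₀σ⟩ := exists_nonscalar_hermStar_eq_sq_eq_smul σ !![(0 : w.1.adicCompletion L), 1; 1, 0] hσσ hGh hG h20 hσϖ hϖ0 hA hgu
  set κ : Matrix (Fin 2) (Fin 2) (w.1.adicCompletion L) := α₀ • (1 : Matrix (Fin 2) (Fin 2) (w.1.adicCompletion L)) + β₀ • g with hκdef
  have hκns : ∀ t : w.1.adicCompletion L, κ ≠ t • 1 := kappa_ne_smul_one hκdef hβ₀ (ne_smul_one_of_eval_charpoly_ne_zero hA)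
  obtain ⟨htr, -⟩ := trace_eq_zero_and_det_eq_of_sq hsq hκns
  have hns : ¬ IsSquare k₀ := not_isSquare_of_kappa hA hκdef hβ₀ hsq
  have hk₀0 : k₀ ≠ 0 := fun h0 => hns ⟨0, by rw [h0, mul_zero]⟩
  -- `k₀` is σ-fixed, hence of EVEN order `|k₀| = |ϖ|^{2k}`; rescale by `c = ϖ^{−k}`
  obtain ⟨k, hk⟩ := exists_valued_eq_zpow_two_mul_of_galAdicCompletionMap_eq_of_ramified L (IsCMField.complexConj L) hc1 v w hw he h2 hϖ hσϖ hk₀0 hk₀σ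
  set c : w.1.adicCompletion L := ϖ ^ (-k) with hcdef
  have hc0 : c ≠ 0 := zpow_ne_zero _ hϖ0
  obtain ⟨s₀, hs₀, hσc⟩ := exists_sign_galAdicCompletionMap_zpow_of_eq_neg L w hw hσϖ (-k)
  rw [← hcdef] at hσc
  have hσs₀ : σ s₀ = s₀ := by rcases hs₀ with rfl | rfl <;> simp
  have hss : s₀ * s₀ = 1 := by rcases hs₀ with rfl | rfl <;> norm_num
  have hvs₀ : Valued.v s₀ = 1 := by rcases hs₀ with rfl | rfl <;> simp
  set D : w.1.adicCompletion L := c * c * k₀ with hDdef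
  have hσD : σ D = D := by
    rw [hDdef, map_mul, map_mul, hσc, hk₀σ]
    linear_combination (c * c * k₀) * hss
  have hvD : Valued.v D = 1 := by
    rw [hDdef, map_mul, map_mul, hk, hcdef, map_zpow₀, ← zpow_add₀ (by rw [hϖ]; exact WithZero.coe_ne_zero), ← zpow_add₀ (by rw [hϖ]; exact WithZero.coe_ne_zero)]
    rw [show -k + -k + 2 * k = 0 by ring, zpow_zero]
  have hnsD : ¬ IsSquare D := by
    rintro ⟨d, hd⟩
    apply hns
    refine ⟨d * c⁻¹, ?_⟩
    have : k₀ = D * (c⁻¹ * c⁻¹) := by rw [hDdef]; field_simp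
    rw [this, hd]; ring
  -- `Π = c • κ`: traceless, `Π² = D`, `⋆`-eigen of sign `s₀`
  set P : Matrix (Fin 2) (Fin 2) (w.1.adicCompletion L) := c • κ with hPdef
  have hPtr : P.trace = 0 := by rw [hPdef, Matrix.trace_smul, htr, smul_zero]
  have hPsq : P * P = D • (1 : Matrix (Fin 2) (Fin 2) (w.1.adicCompletion L)) := by
    rw [hPdef, smul_mul_smul_comm, hsq, smul_smul, hDdef]
  have hPs' : hermStar σ !![(0 : w.1.adicCompletion L), 1; 1, 0] P = s₀ • P := by
    rw [hPdef, hermStar_smul, hκs, hσc, smul_smul]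
  have hPs : (P.map σ)ᵀ * !![(0 : w.1.adicCompletion L), 1; 1, 0] = !![(0 : w.1.adicCompletion L), s₀; s₀, 0] * P := by
    have h := congrArg (fun M => !![(0 : w.1.adicCompletion L), 1; 1, 0] * M) hPs'
    simp only [hermStar_def, ← Matrix.mul_assoc] at h
    rw [Matrix.mul_nonsing_inv _ hG, Matrix.one_mul, Matrix.mul_smul, ← Matrix.smul_mul] at h
    have e : s₀ • (!![(0 : w.1.adicCompletion L), 1; 1, 0] : Matrix (Fin 2) (Fin 2) (w.1.adicCompletion L)) = !![(0 : w.1.adicCompletion L), s₀; s₀, 0] := by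
      ext i j; fin_cases i <;> fin_cases j <;> simp
    rw [h, e]
  obtain ⟨hp, hq, hr, h11, hDsum⟩ := sqrtGenerator_shape_signed σ P s₀ hPs hPtr hPsq
  -- coordinates of `g` in `⟨1, Π⟩`
  set φ₀ : w.1.adicCompletion L := -(α₀ * β₀⁻¹) with hφ₀def
  set φ₁ : w.1.adicCompletion L := β₀⁻¹ * c⁻¹ with hφ₁def
  have hgφ : g = φ₀ • (1 : Matrix (Fin 2) (Fin 2) (w.1.adicCompletion L)) + φ₁ • P := by
    rw [hPdef, hκdef, hφ₀def, hφ₁def]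
    exact eq_smul_one_add_smul_rescaled_kappa hβ₀ hc0 g
  have hglit : g = !![φ₀ + φ₁ * P 0 0, φ₁ * P 0 1; φ₁ * P 1 0, φ₀ - φ₁ * P 0 0] := by
    rw [hgφ]
    exact smul_one_add_smul_eq_literal φ₀ φ₁ h11
  have hr0 : P 1 0 ≠ 0 := by
    intro h0
    apply hnsD
    exact ⟨P 0 0, by rw [← hDsum, h0, mul_zero, add_zero]⟩
  have hgu' := hgu
  rw [hglit] at hgu'
  obtain ⟨R1, R2⟩ := typeTwo_relations_of_unitary_signed σ hp hr hDsum hr0 hgu'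
  exact ⟨P 0 0, P 0 1, P 1 0, D, φ₀, φ₁, s₀, hs₀, hσs₀, hp, hq, hr, hσD, hDsum, hr0, hvD, hnsD, hglit, R1, R2⟩

/-! ## §2 The twist data: `x, y` integral, `σx = x`, `σy = s₀y`, `x² − Dy² ≡ −s₀ (mod 𝔪_w)` -/

/-- Ultrametric: if `|a − a′| < 1`, `|a| ≤ 1`, `|a′| ≤ 1` then `|a² − a′²| < 1`. [cite: Serre1979, Ch. II §1] -/
theorem valued_sq_sub_sq_lt_one {K : Type*} [Field K] [Valued K (WithZero (Multiplicative ℤ))] {a a' : K}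
    (h : Valued.v (a - a') < 1) (ha : Valued.v a ≤ 1) (ha' : Valued.v a' ≤ 1) : Valued.v (a * a - a' * a') < 1 := by
  have e : a * a - a' * a' = (a - a') * (a + a') := by ring
  rw [e, Valuation.map_mul]
  calc Valued.v (a - a') * Valued.v (a + a') ≤ Valued.v (a - a') * 1 :=
        mul_le_mul' le_rfl ((Valuation.map_add _ _ _).trans (max_le ha ha'))
    _ < 1 := by rw [mul_one]; exact h

include hw in
/-- **THE TWIST DATA AT A TAMELY RAMIFIED PLACE.**  For `s₀ ∈ {1, −1}` and a σ-fixed unit `D` there are integral `x, y ∈ L_w` with `σx = x`, `σy = s₀y` and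
`|x² − D·y² + s₀|_w < 1`: `(x, y) = (1, 0)` if `s₀ = −1`; if `s₀ = 1`, a root `ā² + 1 − D̄b̄² = 0` in the finite residue field of ODD cardinality (`|2|_w = 1`; Mathlib
`FiniteField.exists_root_sum_quadratic`) lifted to `𝒪_w` and σ-symmetrised (`σ` is residually trivial at a ramified place, ★ `ramifiedBlock_adicCompletion`).  With it
`−det Ψ_{x,y} = −s₀D(x² − Dy²) ≡ D`. [cite: Serre1979, Ch. V §3; Ch. XIV §4] [cite: LabesseLanglands1979, §2 pp. 8–10] -/
theorem exists_twistData_ramified (he : v.asIdeal.ramificationIdx' w.1.asIdeal ≠ 1) (h2 : Valued.v (2 : w.1.adicCompletion L) = 1)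
    {D s₀ : w.1.adicCompletion L} (hs₀ : s₀ = 1 ∨ s₀ = -1) (hvD : Valued.v D = 1) :
    ∃ x y : w.1.adicCompletion L, galAdicCompletionMap (L := L) (IsCMField.complexConj L) hw x = x ∧
      galAdicCompletionMap (L := L) (IsCMField.complexConj L) hw y = s₀ * y ∧ Valued.v x ≤ 1 ∧ Valued.v y ≤ 1 ∧
      Valued.v (x * x - D * (y * y) + s₀) < 1 := by
  classical
  set σ := galAdicCompletionMap (L := L) (IsCMField.complexConj L) hw with hσdef
  rcases hs₀ with rfl | rfl
  swap
  · refine ⟨1, 0, map_one σ, by rw [map_zero, mul_zero], by rw [map_one], by rw [map_zero]; exact zero_le, ?_⟩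
    have e : (1 : w.1.adicCompletion L) * 1 - D * (0 * 0) + -1 = 0 := by ring
    rw [e, map_zero]; exact zero_lt_one
  -- `s₀ = 1`
  have hc1 : IsCMField.complexConj L ≠ 1 := IsCMField.complexConj_ne_one L
  have hσσ : ∀ x, σ (σ x) = x := fun x => galAdicCompletionMap_galAdicCompletionMap_of_smul_eq (IsCMField.complexConj L) w hc1 hw x
  have hvσ : ∀ x, Valued.v (σ x) = Valued.v x := fun x => valued_galAdicCompletionMap (L := L) (IsCMField.complexConj L) hw x
  obtain ⟨-, -, -, hres, -⟩ := ramifiedBlock_adicCompletion L v w hw he h2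
  have h20 : (2 : w.1.adicCompletion L) ≠ 0 := fun h0 => by rw [h0, map_zero] at h2; exact zero_ne_one h2
  haveI : Finite (𝓞 L ⧸ w.1.asIdeal) := Ideal.finiteQuotientOfFreeOfNeBot _ w.1.ne_bot
  haveI : Finite 𝓀[w.1.adicCompletion L] := inferInstance
  letI : Fintype 𝓀[w.1.adicCompletion L] := Fintype.ofFinite _
  set DO : 𝒪[w.1.adicCompletion L] := ⟨D, (v_le_one_iff_mem_integer D).1 hvD.le⟩ with hDOdef
  have hDu : IsUnit DO := isUnit_integer_of_v_eq_one w.1 hvD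
  have hDbar : IsLocalRing.residue 𝒪[w.1.adicCompletion L] DO ≠ 0 := (IsLocalRing.residue_ne_zero_iff_isUnit DO).2 hDu
  -- odd cardinality of the residue field
  have h2O : IsUnit (2 : 𝒪[w.1.adicCompletion L]) := isUnit_two_integer_of_v_two_eq_one w.1 h2
  have h2bar : (2 : 𝓀[w.1.adicCompletion L]) ≠ 0 := by
    have h := (IsLocalRing.residue_ne_zero_iff_isUnit (2 : 𝒪[w.1.adicCompletion L])).2 h2O
    rwa [map_ofNat] at h
  have hodd : Fintype.card 𝓀[w.1.adicCompletion L] % 2 = 1 := by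
    refine FiniteField.odd_card_of_char_ne_two fun hchar => h2bar ?_
    have h := (ringChar.spec 𝓀[w.1.adicCompletion L] 2).2 (by rw [hchar])
    exact_mod_cast h
  -- a residue solution of `a² + 1 − D̄ b² = 0`
  have hf : (X ^ 2 + C (1 : 𝓀[w.1.adicCompletion L])).degree = 2 := by
    rw [Polynomial.degree_X_pow_add_C (by norm_num)]; rfl
  have hg : (C (-IsLocalRing.residue 𝒪[w.1.adicCompletion L] DO) * X ^ 2).degree = 2 := by
    rw [Polynomial.degree_C_mul_X_pow 2 (neg_ne_zero.2 hDbar)]; rfl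
  obtain ⟨a, b, hab⟩ := FiniteField.exists_root_sum_quadratic hf hg hodd
  simp only [eval_add, eval_pow, eval_X, eval_C, eval_mul] at hab
  obtain ⟨a', rfl⟩ := IsLocalRing.residue_surjective a
  obtain ⟨b', rfl⟩ := IsLocalRing.residue_surjective b
  have hz : IsLocalRing.residue 𝒪[w.1.adicCompletion L] (a' * a' + 1 - DO * (b' * b')) = 0 := by
    rw [map_sub, map_add, map_mul, map_one, map_mul, map_mul]
    linear_combination hab
  have hzv : Valued.v ((a' : w.1.adicCompletion L) * a' + 1 - D * ((b' : w.1.adicCompletion L) * b')) < 1 := by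
    have h := (residue_eq_zero_iff_valuation_lt_one _).1 hz
    rw [← v_lt_one_iff_valuation_lt_one] at h
    simpa [hDOdef] using h
  have ha' : Valued.v (a' : w.1.adicCompletion L) ≤ 1 := (v_le_one_iff_mem_integer _).2 a'.2
  have hb' : Valued.v (b' : w.1.adicCompletion L) ≤ 1 := (v_le_one_iff_mem_integer _).2 b'.2
  -- σ-symmetrise
  have hσ2 : σ 2⁻¹ = 2⁻¹ := by rw [map_inv₀, map_ofNat]
  have hv2i : Valued.v (2⁻¹ : w.1.adicCompletion L) = 1 := by rw [map_inv₀, h2, inv_one]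
  have hsymm : ∀ z : w.1.adicCompletion L, Valued.v z ≤ 1 →
      σ (2⁻¹ * (z + σ z)) = 2⁻¹ * (z + σ z) ∧ Valued.v (2⁻¹ * (z + σ z) - z) < 1 ∧ Valued.v (2⁻¹ * (z + σ z)) ≤ 1 := by
    intro z hz1
    refine ⟨by rw [map_mul, hσ2, map_add, hσσ, add_comm], ?_, ?_⟩
    · have e : 2⁻¹ * (z + σ z) - z = 2⁻¹ * (σ z - z) := by field_simp; ring
      rw [e, Valuation.map_mul, hv2i, one_mul]; exact hres z hz1
    · rw [Valuation.map_mul, hv2i, one_mul]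
      refine (Valuation.map_add _ _ _).trans (max_le hz1 ?_)
      rw [hvσ]; exact hz1
  obtain ⟨hσx, hxa, hx1⟩ := hsymm (a' : w.1.adicCompletion L) ha'
  obtain ⟨hσy, hyb, hy1⟩ := hsymm (b' : w.1.adicCompletion L) hb'
  refine ⟨2⁻¹ * ((a' : w.1.adicCompletion L) + σ a'), 2⁻¹ * ((b' : w.1.adicCompletion L) + σ b'), hσx, by rw [one_mul]; exact hσy, hx1, hy1, ?_⟩
  have e : 2⁻¹ * ((a' : w.1.adicCompletion L) + σ a') * (2⁻¹ * ((a' : w.1.adicCompletion L) + σ a')) -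
      D * (2⁻¹ * ((b' : w.1.adicCompletion L) + σ b') * (2⁻¹ * ((b' : w.1.adicCompletion L) + σ b'))) + 1 =
      ((a' : w.1.adicCompletion L) * a' + 1 - D * ((b' : w.1.adicCompletion L) * b')) +
        ((2⁻¹ * ((a' : w.1.adicCompletion L) + σ a') * (2⁻¹ * ((a' : w.1.adicCompletion L) + σ a')) - (a' : w.1.adicCompletion L) * a') -
          D * (2⁻¹ * ((b' : w.1.adicCompletion L) + σ b') * (2⁻¹ * ((b' : w.1.adicCompletion L) + σ b')) - (b' : w.1.adicCompletion L) * b')) := by ring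
  rw [e]
  refine Valuation.map_add_lt _ hzv (Valuation.map_sub_lt _ (valued_sq_sub_sq_lt_one hxa hx1 ha') ?_)
  rw [Valuation.map_mul, hvD, one_mul]
  exact valued_sq_sub_sq_lt_one hyb hy1 hb'

end CM

end Literature.NumberTheory.Rogawski1990

end
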